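import Summits.Ventures.PercRepro.S1EightSixLineParts

/-!
# PercRepro — THE SHAPE `(rank 6 on 10) ⊕ U_{2,4}` OF THE `(8, 6)` CELL (p2, gen 28; SUBCLAIM-S1 §6.10 (xvii)(p);
PARTIAL — towards the `(8, 6)` capstone)

`M` coloop-free of rank `6` on `10` points (a corank-`4` part), `N = U_{2,4}`. `#U ≤ 6 N_M(6, 2) + 4 N_M(6, 3) +
N_M(6, 4)` with `N_M(6, 4) ≤ s₆` (a spanning `6`-set — Theorem M at `(6, 4)` is vacuous), Theorem N at `(6, 2)` and
Theorem M at `(6, 3)` on `M`; `#Y ≥ 11 f_M(3) + 15 f_M(4) + 16 f_M(5) + 5 f_M(6)` with `f_M(6) ≥ 11 + s₆` (the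
ground set, the ten `9`-sets, the spanning `6`-sets) and `s₆ ≤ C(10, 6) = 210`:
`Φ(8, 4) · #U ≤ 4.68 f_M(3) + 11.43 (f_M(4) + f_M(5)) + 5.07 s₆ ≤ 11 f_M(3) + 15 f_M(4) + 16 f_M(5) + 5 (11 + s₆)`.
Nothing is claimed about any cell.

* `profileSet_six_four_subset_spanning_six`, `ncard_rankSet_six_ge_rank_six_ten`;
* `c025_eight_four_disjointSum_rank_six_ten_line_four`.
Axioms: standard.
-/

open scoped Matroid

namespace PercRepro

namespace S1

open Set

variable {α : Type}

section RankSixOnTen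

variable {M : Matroid α} [M.Finite]

/-- On `10` points of rank `6`, a spanning set whose complement has rank `4` is a spanning `6`-set. -/
theorem profileSet_six_four_subset_spanning_six (hE : M.E.ncard = 10) :
    profileSet M 6 4 ⊆ {A : Set α | A ⊆ M.E ∧ A.ncard = 6 ∧ M.eRk A = ((6 : ℕ) : ℕ∞)} := by
  rintro A ⟨hAE, hA6, hAc⟩
  have hAfin : A.Finite := M.ground_finite.subset hAE
  have h1 : ((6 : ℕ) : ℕ∞) ≤ (A.ncard : ℕ∞) := by
    rw [← hA6, hAfin.cast_ncard_eq]; exact M.eRk_le_encard A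
  have h2 : ((4 : ℕ) : ℕ∞) ≤ ((M.E \ A).ncard : ℕ∞) := by
    rw [← hAc, (M.ground_finite.subset sdiff_subset).cast_ncard_eq]; exact M.eRk_le_encard _
  have h3 : A.ncard + (M.E \ A).ncard = M.E.ncard := by
    rw [← ncard_union_eq disjoint_sdiff_right hAfin (M.ground_finite.subset sdiff_subset), union_sdiff_cancel hAE]
  have h1' : 6 ≤ A.ncard := by exact_mod_cast h1
  have h2' : 4 ≤ (M.E \ A).ncard := by exact_mod_cast h2
  exact ⟨hAE, by omega, hA6⟩

/-- `f(6) ≥ 11 + s₆`: the ground set, the ten `9`-sets (they span: a coloop-free matroid) and the spanning `6`-sets. -/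
theorem ncard_rankSet_six_ge_rank_six_ten (hM : M.eRank = ((6 : ℕ) : ℕ∞)) (hE : M.E.ncard = 10)
    (hcol : M.coloops = ∅) :
    11 + {A : Set α | A ⊆ M.E ∧ A.ncard = 6 ∧ M.eRk A = ((6 : ℕ) : ℕ∞)}.ncard ≤ (rankSet M 6).ncard := by
  have hf : ∀ k : ℕ, {A : Set α | A ⊆ M.E ∧ A.ncard = k}.Finite := fun k =>
    M.ground_finite.finite_subsets.subset (fun _ hA => hA.1)
  have hS : {A : Set α | A ⊆ M.E ∧ A.ncard = 6 ∧ M.eRk A = ((6 : ℕ) : ℕ∞)}.Finite :=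
    (hf 6).subset (fun _ hA => ⟨hA.1, hA.2.1⟩)
  have hsub : {M.E} ∪ {A : Set α | A ⊆ M.E ∧ A.ncard = 9} ∪
      {A : Set α | A ⊆ M.E ∧ A.ncard = 6 ∧ M.eRk A = ((6 : ℕ) : ℕ∞)} ⊆ rankSet M 6 := by
    rintro A ((hA | ⟨hAE, h9⟩) | ⟨hAE, -, h6⟩)
    · rw [mem_singleton_iff] at hA; subst hA
      exact ⟨subset_rfl, by rw [M.eRk_ground, hM]⟩
    · refine ⟨hAE, ?_⟩
      have hhi : M.eRk A ≤ M.eRank := M.eRk_le_eRank A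
      rw [hM] at hhi
      obtain ⟨n, hn⟩ := ENat.ne_top_iff_exists.mp (ne_top_of_le_ne_top (by decide) hhi)
      rw [← hn] at hhi ⊢
      have hhi' : n ≤ 6 := by exact_mod_cast hhi
      rcases Nat.lt_or_ge n 6 with h | h
      · exfalso
        have hmiss := sub_add_one_le_ncard_ground_sdiff_of_coloops M hM hcol hAE hn.symm h
        rw [ncard_sdiff' hAE M.ground_finite, hE, h9] at hmiss
        omega
      · have : n = 6 := by omega
        rw [this]
    · exact ⟨hAE, h6⟩
  have h := ncard_le_ncard hsub (rankSet_finite M 6)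
  rw [ncard_union_eq (by
        rw [Set.disjoint_left]
        rintro A (hA | ⟨-, h9⟩) ⟨-, h6, -⟩
        · rw [mem_singleton_iff] at hA; subst hA; omega
        · omega) ((finite_singleton _).union (hf 9)) hS,
    ncard_union_eq (by
        rw [Set.disjoint_left]
        rintro A hA ⟨-, h9⟩
        rw [mem_singleton_iff] at hA; subst hA; omega) (finite_singleton _) (hf 9),
    ncard_singleton, ncard_setOf_subset_ncard_eq M.ground_finite 9, hE, show Nat.choose 10 9 = 10 by decide] at h
  omega

end RankSixOnTen

/-- The arithmetic of `(rank 6 on 10) ⊕ U_{2,4}` at `(8, 4)`. -/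
theorem consumer_arith_rank_six_ten_line_four {u y P2 P3 S6 f3 f4 f5 f6 : ℚ} (hU : u ≤ 6 * P2 + 4 * P3 + S6)
    (h62 : 13 / 2 * P2 ≤ f3 + f4 + f5) (h63 : 3 * P3 ≤ f4 + f5) (h6 : 11 + S6 ≤ f6) (hS6 : S6 ≤ 210)
    (hY : 11 * f3 + 15 * f4 + 16 * f5 + 5 * f6 ≤ y) (hf3 : 0 ≤ f3) (hf4 : 0 ≤ f4) (hf5 : 0 ≤ f5) :
    76 / 15 * u ≤ y := by
  linarith

/-- **`M ⊕ U_{2,4}` at `(8, 4)`**: `M` coloop-free of rank `6` on `10` points with all pairs of rank `2`, `N` of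
rank `2` on `4` points with all pairs of rank `2`. -/
theorem c025_eight_four_disjointSum_rank_six_ten_line_four (M N : Matroid α) [M.Finite] [N.Finite]
    (h : Disjoint M.E N.E) (hM : M.eRank = ((6 : ℕ) : ℕ∞)) (hME : M.E.ncard = 10) (hcolM : M.coloops = ∅)
    (hN : N.eRank = ((2 : ℕ) : ℕ∞)) (hNE : N.E.ncard = 4)
    (hpairsN : ∀ e ∈ N.E, ∀ f ∈ N.E, e ≠ f → N.eRk {e, f} = 2) :
    phiK 8 4 * ({A : Set α | A ⊆ (M.disjointSum N h).E ∧ (M.disjointSum N h).eRk A = ((8 : ℕ) : ℕ∞) ∧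
        (M.disjointSum N h).eRk ((M.disjointSum N h).E \ A) = ((4 : ℕ) : ℕ∞)}.ncard : ℚ) ≤
      ({A : Set α | A ⊆ (M.disjointSum N h).E ∧ ((4 : ℕ) : ℕ∞) < (M.disjointSum N h).eRk A ∧
        (M.disjointSum N h).eRk A < ((8 : ℕ) : ℕ∞)}.ncard : ℚ) := by
  have hSfin : {A : Set α | A ⊆ M.E ∧ A.ncard = 6 ∧ M.eRk A = ((6 : ℕ) : ℕ∞)}.Finite :=
    M.ground_finite.finite_subsets.subset (fun _ hA => hA.1)
  have hS6 : {A : Set α | A ⊆ M.E ∧ A.ncard = 6 ∧ M.eRk A = ((6 : ℕ) : ℕ∞)}.ncard ≤ 210 := by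
    have := ncard_le_ncard (show {A : Set α | A ⊆ M.E ∧ A.ncard = 6 ∧ M.eRk A = ((6 : ℕ) : ℕ∞)} ⊆
      {A : Set α | A ⊆ M.E ∧ A.ncard = 6} from fun A hA => ⟨hA.1, hA.2.1⟩)
      (M.ground_finite.finite_subsets.subset (fun _ hA => hA.1))
    rwa [ncard_setOf_subset_ncard_eq M.ground_finite 6, hME, show Nat.choose 10 6 = 210 by decide] at this
  -- the `U`-side: the slices `(6, 2)`, `(6, 3)`, `(6, 4)`
  have hU : {A : Set α | A ⊆ (M.disjointSum N h).E ∧ (M.disjointSum N h).eRk A = ((8 : ℕ) : ℕ∞) ∧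
      (M.disjointSum N h).eRk ((M.disjointSum N h).E \ A) = ((4 : ℕ) : ℕ∞)}.ncard ≤
      6 * (profileSet M 6 2).ncard + 4 * (profileSet M 6 3).ncard +
        {A : Set α | A ⊆ M.E ∧ A.ncard = 6 ∧ M.eRk A = ((6 : ℕ) : ℕ∞)}.ncard := by
    rw [disjointSum_ncard_U_eq_finsum M N h 8 4, finsum_mem_coe_finset]
    have hsub : ({(6, 2), (6, 3), (6, 4)} : Finset (ℕ × ℕ)) ⊆ Finset.range (8 + 1) ×ˢ Finset.range (4 + 1) := by
      decide
    rw [← Finset.sum_subset hsub ?_]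
    · rw [Finset.sum_insert (by decide), Finset.sum_insert (by decide), Finset.sum_singleton]
      dsimp only
      show (profileSet M 6 2).ncard * (profileSet N 2 2).ncard + ((profileSet M 6 3).ncard * (profileSet N 2 1).ncard +
        (profileSet M 6 4).ncard * (profileSet N 2 0).ncard) ≤ _
      have g22 := ncard_profileSet_le_choose_of_ncard_eq (N := N) (a := 2) (b := 2) hNE
      rw [show Nat.choose (2 + 2) 2 = 6 by decide] at g22
      have g21 := ncard_profileSet_top_one_le_of_pairs' hpairsN 2
      rw [hNE] at g21
      have g20 := ncard_profileSet_top_zero_le_of_pairs N hpairsN (by omega) 2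
      have h64 := ncard_le_ncard (profileSet_six_four_subset_spanning_six hME) hSfin
      have e1 := Nat.mul_le_mul_left (profileSet M 6 2).ncard g22
      have e2 := Nat.mul_le_mul_left (profileSet M 6 3).ncard g21
      have e3 := Nat.mul_le_mul h64 g20
      nlinarith [e1, e2, e3]
    · rintro ⟨a, b⟩ hmem hnot
      rw [Finset.mem_product, Finset.mem_range, Finset.mem_range] at hmem
      simp only [Finset.mem_insert, Finset.mem_singleton, Prod.mk.injEq, not_or] at hnot
      dsimp only
      rcases Nat.lt_or_ge 6 a with ha | ha
      · rw [profileSet_eq_empty_of_eRank_lt M hM ha b, ncard_empty, zero_mul]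
      rcases Nat.lt_or_ge a 6 with ha' | ha'
      · have h8a : 2 < 8 - a := by omega
        rw [profileSet_eq_empty_of_eRank_lt N hN h8a (4 - b), ncard_empty, mul_zero]
      have ha6 : a = 6 := by omega
      subst ha6
      rw [show (8 : ℕ) - 6 = 2 from rfl]
      have hb : b < 2 := by omega
      rw [profileSet_eq_empty_of_eRank_lt_snd N hN (by omega) 2, ncard_empty, mul_zero]
  -- the `Y`-side
  have hY : 11 * (rankSet M 3).ncard + 15 * (rankSet M 4).ncard + 16 * (rankSet M 5).ncard +
      5 * (rankSet M 6).ncard ≤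
      {A : Set α | A ⊆ (M.disjointSum N h).E ∧ ((4 : ℕ) : ℕ∞) < (M.disjointSum N h).eRk A ∧
        (M.disjointSum N h).eRk A < ((8 : ℕ) : ℕ∞)}.ncard := by
    rw [disjointSum_ncard_Y_eq_finsum M N h 8 4, finsum_mem_coe_finset]
    have hsub : ({(3, 2), (4, 1), (4, 2), (5, 0), (5, 1), (5, 2), (6, 0), (6, 1)} : Finset (ℕ × ℕ)) ⊆
        (Finset.range 8 ×ˢ Finset.range 8).filter (fun x : ℕ × ℕ => 4 < x.1 + x.2 ∧ x.1 + x.2 < 8) := by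
      decide
    refine le_trans ?_ (Finset.sum_le_sum_of_subset hsub)
    rw [Finset.sum_insert (by decide), Finset.sum_insert (by decide), Finset.sum_insert (by decide),
      Finset.sum_insert (by decide), Finset.sum_insert (by decide), Finset.sum_insert (by decide),
      Finset.sum_insert (by decide), Finset.sum_singleton]
    dsimp only
    have f0 : 1 ≤ (rankSet N 0).ncard := by
      have h0 : (∅ : Set α) ∈ rankSet N 0 := ⟨empty_subset _, by rw [N.eRk_empty]; rfl⟩
      exact (ncard_pos (rankSet_finite N 0)).mpr ⟨∅, h0⟩
    have f1 : 4 ≤ (rankSet N 1).ncard := by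
      have := ncard_le_ncard_rankSet_one_of_pairs hpairsN (by omega)
      rwa [hNE] at this
    have f2 : 11 ≤ (rankSet N 2).ncard := by
      have := ncard_rankSet_two_ge_of_rank_two N hN hpairsN
      rwa [hNE, show 2 ^ 4 - 1 - 4 = 11 by decide] at this
    have e32 := Nat.mul_le_mul_left (rankSet M 3).ncard f2
    have e41 := Nat.mul_le_mul_left (rankSet M 4).ncard f1
    have e42 := Nat.mul_le_mul_left (rankSet M 4).ncard f2
    have e50 := Nat.mul_le_mul_left (rankSet M 5).ncard f0
    have e51 := Nat.mul_le_mul_left (rankSet M 5).ncard f1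
    have e52 := Nat.mul_le_mul_left (rankSet M 5).ncard f2
    have e60 := Nat.mul_le_mul_left (rankSet M 6).ncard f0
    have e61 := Nat.mul_le_mul_left (rankSet M 6).ncard f1
    linarith
  have h6 := ncard_rankSet_six_ge_rank_six_ten hM hME hcolM
  -- the tree cells on `M`
  have h62 : (13 / 2 : ℚ) * ((profileSet M 6 2).ncard : ℚ) ≤
      ((rankSet M 3).ncard : ℚ) + ((rankSet M 4).ncard : ℚ) + ((rankSet M 5).ncard : ℚ) := by
    have h0 := ThmN.c025_two_all M 6 (by norm_num)
    unfold ThmN.RLS at h0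
    rw [phiK_six_two,
      ySet_eq_rankSet_union3_of_eq M (q := 2) (p := 6) (k := 3) (k' := 4) (k'' := 5) rfl rfl rfl rfl,
      ncard_union_eq (Set.disjoint_union_left.mpr
        ⟨rankSet_disjoint_of_ne M (by norm_num), rankSet_disjoint_of_ne M (by norm_num)⟩)
        ((rankSet_finite M 3).union (rankSet_finite M 4)) (rankSet_finite M 5),
      ncard_union_eq (rankSet_disjoint_of_ne M (by norm_num)) (rankSet_finite M 3) (rankSet_finite M 4)] at h0
    push_cast at h0
    exact h0
  have h63 : (3 : ℚ) * ((profileSet M 6 3).ncard : ℚ) ≤ ((rankSet M 4).ncard : ℚ) + ((rankSet M 5).ncard : ℚ) := by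
    have h0 := SevenThree.c025_three_all M 6 (by norm_num)
    unfold ThmN.RLS at h0
    rw [phiK_six_three, ySet_eq_rankSet_union_of_eq M (q := 3) (p := 6) (k := 4) (k' := 5) rfl rfl rfl,
      ncard_union_eq (rankSet_disjoint_of_ne M (by norm_num)) (rankSet_finite M 4) (rankSet_finite M 5)] at h0
    push_cast at h0
    exact h0
  rw [phiK_eight_four]
  have hU' : (({A : Set α | A ⊆ (M.disjointSum N h).E ∧ (M.disjointSum N h).eRk A = ((8 : ℕ) : ℕ∞) ∧
      (M.disjointSum N h).eRk ((M.disjointSum N h).E \ A) = ((4 : ℕ) : ℕ∞)}.ncard : ℕ) : ℚ) ≤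
      6 * ((profileSet M 6 2).ncard : ℚ) + 4 * ((profileSet M 6 3).ncard : ℚ) +
        ({A : Set α | A ⊆ M.E ∧ A.ncard = 6 ∧ M.eRk A = ((6 : ℕ) : ℕ∞)}.ncard : ℚ) := by
    exact_mod_cast hU
  have hY' : 11 * ((rankSet M 3).ncard : ℚ) + 15 * ((rankSet M 4).ncard : ℚ) + 16 * ((rankSet M 5).ncard : ℚ) +
      5 * ((rankSet M 6).ncard : ℚ) ≤
      (({A : Set α | A ⊆ (M.disjointSum N h).E ∧ ((4 : ℕ) : ℕ∞) < (M.disjointSum N h).eRk A ∧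
        (M.disjointSum N h).eRk A < ((8 : ℕ) : ℕ∞)}.ncard : ℕ) : ℚ) := by
    exact_mod_cast hY
  exact consumer_arith_rank_six_ten_line_four hU' h62 h63 (by exact_mod_cast h6) (by exact_mod_cast hS6) hY'
    (Nat.cast_nonneg _) (Nat.cast_nonneg _) (Nat.cast_nonneg _)

end S1

end PercRepro
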